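import Summits.BirchSwinnertonDyer.BirchSwinnertonDyer.Theorems.EisensteinPrimesAcTwistDeformationCurveSurAtVbar
import Summits.BirchSwinnertonDyer.BirchSwinnertonDyer.Theorems.EisensteinPrimesAcTwistDeformationSurAtVbar
import HarnessLib

/-!
# Route `EisensteinPrimes` (rung K5), crux 2 `GoodLatticeBDPValue`, line `halves` v19.1, V21 index road:
# inputs S1 (SUR_θ at `v̄`) and S2 (SUR_f at `v̄`) IN THE CURRENCY OF THE LEAD'S MID-LEVEL COMPOSITION
# (`ResidualIndexAssembly.zpCorank_datumStrictSelmer_add_eq`, hypotheses `hsur₁ hsur₂ hsur₃`): families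
# indexed by `Fin (p^c)` for a GIVEN exponent `c` (helper for stmt-BirchSwinnertonDyer-19032)

Cell `bsd-eis` (home `run/shared/lean/pub/bsd-eis/`), seat `bsd-line-x1-p1-w3` gen 3 (D-0154 width seat
on crux 2 `GoodLatticeBDPValue`, line `halves` v19.1). The LEAD's (g4) mid-level composition p645893
takes the global-to-local surjectivity at the `p^c` places of `K_∞` above `𝔭 = v̄` in the form
`hsur_k : ∀ y : Fin (p ^ c) → H¹(H ⊓ D_𝔭, A_k), ∃ u ∈ unramifiedOutside H A_k p S₀, ∀ i : Fin (p ^ c),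
res_{H ⊓ D_𝔭}(conj_{τ i} u) = y i`, with `H = ker κ`, `S₀ = ↑Sf`, `τ i = γ^i` and ONE exponent `c` shared
with Brink's representatives hypothesis `hreps_k`. The seat's S1 (p642242
`exists_forall_resOfLe_conjH1_pow_eq_at_vbar_of_RH`, the two characters of the residual pair) and S2
(p646772 `curve_exists_forall_resOfLe_conjH1_pow_eq_at_vbar`, `E[p^∞]`) produce `∃ c` characterised by
`κ(D_v̄) = p^c ℤ_p` EXACTLY (`∃ δ ∈ D_v̄, κ δ = p^c` and `p^c ∣ κ δ` on `D_v̄`). THIS FILE converts them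
into the LEAD's shape for ANY `c` with that characterisation (the exponent is unique,
`eq_of_pow_generates`) and `ℕ`-families into `Fin (p^c)`-families:

* `eq_of_pow_generates` — two exponents `c, c'` with `κ(D) = p^c ℤ_p = p^{c'} ℤ_p` exactly are equal
  (`p` is irreducible in `ℤ_p`);
* **`char_forall_fin_exists_unramifiedOutside_resOfLe_conjH1_pow_eq`** (S1, `θ ∈ {θsub, θquot}`, from
  [RH] at `S₀ = ∅` for `θ` + the five Greenberg facts by name) and
  **`curve_forall_fin_exists_unramifiedOutside_resOfLe_conjH1_pow_eq`** (S2, `E_K[p^∞]`, from the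
  `Sf`-imprimitive cotorsion of the two characters + the five facts by name): for every `c` with
  `κ(D_v̄) = p^c ℤ_p` exactly and every `y : Fin (p^c) → H¹(ker κ ⊓ D_v̄, A)` there is
  `u ∈ unramifiedOutside κ.kerSubgroup A p ↑Sf` with `res(conj_{γ^i} u) = y i` for all `i : Fin (p^c)` —
  literally the `hsur_k` of p645893 at `H = κ.kerSubgroup`, `𝔭 = v̄`, `S₀ = ↑Sf`, `τ = (γ ^ ·)`.

Theorems only; conditional only through the by-name published facts and the [RH] / [PWL-θ]-type
hypotheses the composition p636387 already holds (`hRHsub/hRHquot`, `hSsub/hSquot`); no definition, no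
named fact, no `sorry`. HONEST FRAMING: closes nothing by itself (`--supports`); no summit statement /
BSD / IMC2 / KY Thm. 1.4.1 (iii) is proved by this file; 0 stubs / cells / labels move.
References: [Greenberg2016Selmer] Prop. 2.6.3; [Greenberg2006] Props. 3.2, 4.1, 4.2, §5 A;
[Brink1984] (finitely many places of `K_∞` above `v̄`); [KellerYin2024] Rem. 1.4.2
(arXiv:2402.12781v2 TeX L1130–1140); the road memo `Cruxes/GoodLatticeBDPValue/Lines/halves-imprimLambda-index-road.md` §4.
-/

set_option autoImplicit false
set_option linter.dupNamespace false

noncomputable section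

open scoped Classical
open NumberField IsDedekindDomain Field Multiplicative PowerSeries WeierstrassCurve
open Literature.NumberTheory.EllipticCurves Literature.NumberTheory.EllipticCurves.GreenbergSelmer
  Literature.NumberTheory.EllipticCurves.GreenbergVatsal2000 Literature.NumberTheory.GaloisRepresentations
  Literature.NumberTheory.EllipticCurves.KellerYin2024 Literature.NumberTheory.EllipticCurves.IwasawaDual
  Literature.NumberTheory.EllipticCurves.Castella2018.AcSelmer
  Literature.NumberTheory.IwasawaTheory Literature.NumberTheory.IwasawaTheory.Greenberg2016
  Literature.NumberTheory.IwasawaTheory.Greenberg2006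

namespace Summit.BirchSwinnertonDyer.BirchSwinnertonDyer.Theorems.AcTwistDeformation

section SurAtVbarFin

variable {K : Type} [Field K] [NumberField K] {p : ℕ} [Fact p.Prime]

omit [NumberField K] in
/-- **The exponent of `κ(D) = p^c ℤ_p` is unique**: if `p^c` and `p^{c'}` are both attained by `κ` on
`D` and both divide every value of `κ` on `D`, then `c = c'` (`p` is irreducible in the domain `ℤ_p`,
`pow_dvd_pow_iff`). [folklore] -/
theorem eq_of_pow_generates (κ : ZpExtension K p) (D : Subgroup (absoluteGaloisGroup K)) {c c' : ℕ}
    (hc : ∃ δ ∈ D, (κ δ).toAdd = (p : ℤ_[p]) ^ c) (hcd : ∀ δ ∈ D, (p : ℤ_[p]) ^ c ∣ (κ δ).toAdd)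
    (hc' : ∃ δ ∈ D, (κ δ).toAdd = (p : ℤ_[p]) ^ c') (hc'd : ∀ δ ∈ D, (p : ℤ_[p]) ^ c' ∣ (κ δ).toAdd) :
    c = c' := by
  obtain ⟨δ, hδ, hδc⟩ := hc
  obtain ⟨δ', hδ', hδ'c⟩ := hc'
  have h₁ : (p : ℤ_[p]) ^ c' ∣ (p : ℤ_[p]) ^ c := hδc ▸ hc'd δ hδ
  have h₂ : (p : ℤ_[p]) ^ c ∣ (p : ℤ_[p]) ^ c' := hδ'c ▸ hcd δ' hδ'
  have hp0 : (p : ℤ_[p]) ≠ 0 := PadicInt.irreducible_p.ne_zero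
  have hpu : ¬ IsUnit (p : ℤ_[p]) := PadicInt.irreducible_p.not_isUnit
  exact le_antisymm ((pow_dvd_pow_iff hp0 hpu).mp h₂) ((pow_dvd_pow_iff hp0 hpu).mp h₁)

/-- `ℕ`-families to `Fin (p^c)`-families: a surjectivity statement for all `y : ℕ → Y` at the indices
`i < p^c` gives the one for all `y : Fin (p^c) → Y`. [folklore] -/
theorem forall_fin_of_forall_nat {Y U : Type*} [Zero Y] {n : ℕ} (P : U → Prop) (r : ℕ → U → Y)
    (h : ∀ y : ℕ → Y, ∃ u, P u ∧ ∀ i : ℕ, i < n → r i u = y i) :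
    ∀ y : Fin n → Y, ∃ u, P u ∧ ∀ i : Fin n, r i u = y i := fun y ↦ by
  obtain ⟨u, hu, hru⟩ := h fun i ↦ if hi : i < n then y ⟨i, hi⟩ else 0
  exact ⟨u, hu, fun i ↦ by rw [hru i i.2, dif_pos i.2]⟩

/-- **S1 in the LEAD's currency — SUR_θ at `v̄`, `Fin (p^c)`-families, given exponent.** For
`θ ∈ {θsub, θquot}` of a residual pair of `E[p]` over the imaginary quadratic `K` ((Heeg) for `N_E`,
`2 < p = v v̄`), `κ` anticyclotomic with topological generator `γ`, `Sf` the places over `N_E`, [RH] for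
`θ` at `S₀ = ∅` and the five Greenberg facts by name: for every `c` with `κ(D_v̄) = p^c ℤ_p` exactly and
every `y : Fin (p^c) → H¹(ker κ ⊓ D_v̄, (F/𝒪)(θ))` there is `u ∈ unramifiedOutside κ.kerSubgroup (F/𝒪)(θ) p ↑Sf`
with `res_{ker κ ⊓ D_v̄}(conj_{γ^i} u) = y i` for all `i : Fin (p^c)` — hypothesis `hsur` of
`ResidualIndexAssembly.zpCorank_datumStrictSelmer_add_eq` at `H = κ.kerSubgroup`, `𝔭 = v̄`, `S₀ = ↑Sf`,
`τ = (γ ^ ·)`. From p642242. [cite: Greenberg2016Selmer, Prop. 2.6.3 (c), §4.3 pp. 20–21]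
[cite: KellerYin2024, Rem. 1.4.2 (arXiv:2402.12781v2 TeX L1130–1140)] -/
theorem char_forall_fin_exists_unramifiedOutside_resOfLe_conjH1_pow_eq (h263 : prop263_sur_of_crk)
    (h41 : prop41_globalEulerPoincareCorank) (h42 : prop42_localEulerPoincareCorank)
    (h5A : sec5A_localH2_subsingleton_of_LOC1) (h32 : prop32_cohomology_isCofinitelyGenerated)
    (W : WeierstrassCurve ℚ) [W.IsElliptic] (hp : 2 < p) (hK : IsImaginaryQuadratic K)
    (hH : SatisfiesHeegnerHypothesis (W.conductorNorm ℤ) K)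
    {ι : K →+* ℚ_[p]} {v vbar : HeightOneSpectrum (𝓞 K)}
    (hvι : ∀ x : 𝓞 K, x ∈ v.asIdeal ↔ ‖ι (x : K)‖ < 1)
    (hvbar : ((p : ℕ) : 𝓞 K) ∈ vbar.asIdeal) (hne : vbar ≠ v)
    (κ : ZpExtension K p) (hκ : κ.IsAnticyclotomic) (γ : absoluteGaloisGroup K)
    [Fact (κ.IsTopGenerator γ)]
    {θsub θquot : FramedGaloisRep K (padicCoeffIntegers (∅ : Set (PadicAlgCl p))) 1}
    (hpair : IsResidualPairOver (W.baseChange K) p θsub θquot)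
    (Sf : Finset (HeightOneSpectrum (𝓞 K)))
    (hSf : ∀ w : HeightOneSpectrum (𝓞 K), w ∈ Sf ↔ ((W.conductorNorm ℤ : ℤ) : 𝓞 K) ∈ w.asIdeal)
    (θ : FramedGaloisRep K (padicCoeffIntegers (∅ : Set (PadicAlgCl p))) 1) (hθ : θ = θsub ∨ θ = θquot)
    (hRH : ∀ D : DatumDualData κ γ (charModule (∅ : Set (PadicAlgCl p)) θ)
        (Castella2018.AcSelmer.bdpData (charModule (∅ : Set (PadicAlgCl p)) θ) p vbar)
        (∅ : Set (HeightOneSpectrum (𝓞 K))),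
      Module.Finite (IwasawaAlgebra p) D.X ∧ Module.IsTorsion (IwasawaAlgebra p) D.X ∧
        muInvariant p D.X = 0)
    (c : ℕ) (hc : ∃ δ ∈ decomp (K := K) vbar, (κ δ).toAdd = (p : ℤ_[p]) ^ c)
    (hcd : ∀ δ ∈ decomp (K := K) vbar, (p : ℤ_[p]) ^ c ∣ (κ δ).toAdd) :
    ∀ y : Fin (p ^ c) →
        subgroupH1 (κ.kerSubgroup ⊓ decomp (K := K) vbar) (charModule (∅ : Set (PadicAlgCl p)) θ),
      ∃ u ∈ unramifiedOutside κ.kerSubgroup (charModule (∅ : Set (PadicAlgCl p)) θ) p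
          (↑Sf : Set (HeightOneSpectrum (𝓞 K))),
        ∀ i : Fin (p ^ c),
          resOfLe (charModule (∅ : Set (PadicAlgCl p)) θ)
            (inf_le_left : κ.kerSubgroup ⊓ decomp (K := K) vbar ≤ κ.kerSubgroup)
            (conjH1 κ.kerSubgroup (charModule (∅ : Set (PadicAlgCl p)) θ) (γ ^ (i : ℕ)) u) = y i := by
  obtain ⟨c', hc', hc'd, hsur⟩ := exists_forall_resOfLe_conjH1_pow_eq_at_vbar_of_RH h263 h41 h42 h5A h32
    W hp hK hH hvι hvbar hne κ hκ γ hpair Sf hSf θ hθ hRH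
  obtain rfl : c = c' := eq_of_pow_generates κ (decomp (K := K) vbar) hc hcd hc' hc'd
  exact forall_fin_of_forall_nat
    (fun u ↦ u ∈ unramifiedOutside κ.kerSubgroup (charModule (∅ : Set (PadicAlgCl p)) θ) p
      (↑Sf : Set (HeightOneSpectrum (𝓞 K))))
    (fun i u ↦ resOfLe (charModule (∅ : Set (PadicAlgCl p)) θ)
      (inf_le_left : κ.kerSubgroup ⊓ decomp (K := K) vbar ≤ κ.kerSubgroup)
      (conjH1 κ.kerSubgroup (charModule (∅ : Set (PadicAlgCl p)) θ) (γ ^ i) u))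
    fun y ↦ by
      obtain ⟨u, hu, -, hev⟩ := hsur y
      exact ⟨u, hu, hev⟩

/-- **S2 in the LEAD's currency — SUR_f at `v̄`, `Fin (p^c)`-families, given exponent.** For
`E = W/ℚ` over the imaginary quadratic `K` ((Heeg) for `N_E`, `2 < p = v v̄`), `κ` anticyclotomic with
topological generator `γ`, a residual pair `θsub, θquot`, `Sf` the places over `N_E`, the `Sf`-imprimitive
cotorsion of the two characters (`hSsub`, `hSquot`) and the five Greenberg facts by name: for every `c`
with `κ(D_v̄) = p^c ℤ_p` exactly and every `y : Fin (p^c) → H¹(ker κ ⊓ D_v̄, E_K[p^∞])` there is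
`u ∈ unramifiedOutside κ.kerSubgroup (E_K.geomPrimaryTorsion p) p ↑Sf` with
`res_{ker κ ⊓ D_v̄}(conj_{γ^i} u) = y i` for all `i : Fin (p^c)` — hypothesis `hsur` of
`ResidualIndexAssembly.zpCorank_datumStrictSelmer_add_eq` at `A = E_K[p^∞]`, `H = κ.kerSubgroup`,
`𝔭 = v̄`, `S₀ = ↑Sf`, `τ = (γ ^ ·)`. From p646772. [cite: Greenberg2016Selmer, Prop. 2.6.3 (c), §4.3 pp. 20–21]
[cite: Greenberg2006, Thm. 3 p. 342, Props. 3.2, 4.1, 4.2, §5 A] [cite: KellerYin2024, Rem. 1.4.2 (arXiv:2402.12781v2 TeX L1130–1140)] -/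
theorem curve_forall_fin_exists_unramifiedOutside_resOfLe_conjH1_pow_eq (h263 : prop263_sur_of_crk)
    (h41 : prop41_globalEulerPoincareCorank) (h42 : prop42_localEulerPoincareCorank)
    (h5A : sec5A_localH2_subsingleton_of_LOC1) (h32 : prop32_cohomology_isCofinitelyGenerated)
    (W : WeierstrassCurve ℚ) [W.IsElliptic] (hp : 2 < p) (hK : IsImaginaryQuadratic K)
    (hH : SatisfiesHeegnerHypothesis (W.conductorNorm ℤ) K)
    {ι : K →+* ℚ_[p]} {v vbar : HeightOneSpectrum (𝓞 K)}
    (hvι : ∀ x : 𝓞 K, x ∈ v.asIdeal ↔ ‖ι (x : K)‖ < 1)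
    (hvbar : ((p : ℕ) : 𝓞 K) ∈ vbar.asIdeal) (hne : vbar ≠ v)
    (κ : ZpExtension K p) (hκ : κ.IsAnticyclotomic) (γ : absoluteGaloisGroup K)
    [Fact (κ.IsTopGenerator γ)]
    {θsub θquot : FramedGaloisRep K (padicCoeffIntegers (∅ : Set (PadicAlgCl p))) 1}
    (hpair : IsResidualPairOver (W.baseChange K) p θsub θquot)
    (Sf : Finset (HeightOneSpectrum (𝓞 K)))
    (hSf : ∀ w : HeightOneSpectrum (𝓞 K), w ∈ Sf ↔ ((W.conductorNorm ℤ : ℤ) : 𝓞 K) ∈ w.asIdeal)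
    (hSsub : ∀ D : DatumDualData κ γ (charModule (∅ : Set (PadicAlgCl p)) θsub)
      (bdpData (charModule (∅ : Set (PadicAlgCl p)) θsub) p vbar) (↑Sf : Set (HeightOneSpectrum (𝓞 K))),
      Module.Finite (IwasawaAlgebra p) D.X ∧ Module.IsTorsion (IwasawaAlgebra p) D.X ∧
        muInvariant p D.X = 0)
    (hSquot : ∀ D : DatumDualData κ γ (charModule (∅ : Set (PadicAlgCl p)) θquot)
      (bdpData (charModule (∅ : Set (PadicAlgCl p)) θquot) p vbar) (↑Sf : Set (HeightOneSpectrum (𝓞 K))),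
      Module.Finite (IwasawaAlgebra p) D.X ∧ Module.IsTorsion (IwasawaAlgebra p) D.X ∧
        muInvariant p D.X = 0)
    (c : ℕ) (hc : ∃ δ ∈ decomp (K := K) vbar, (κ δ).toAdd = (p : ℤ_[p]) ^ c)
    (hcd : ∀ δ ∈ decomp (K := K) vbar, (p : ℤ_[p]) ^ c ∣ (κ δ).toAdd) :
    ∀ y : Fin (p ^ c) →
        subgroupH1 (κ.kerSubgroup ⊓ decomp (K := K) vbar) ((W.baseChange K).geomPrimaryTorsion p),
      ∃ u ∈ unramifiedOutside κ.kerSubgroup ((W.baseChange K).geomPrimaryTorsion p) p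
          (↑Sf : Set (HeightOneSpectrum (𝓞 K))),
        ∀ i : Fin (p ^ c),
          resOfLe ((W.baseChange K).geomPrimaryTorsion p)
            (inf_le_left : κ.kerSubgroup ⊓ decomp (K := K) vbar ≤ κ.kerSubgroup)
            (conjH1 κ.kerSubgroup ((W.baseChange K).geomPrimaryTorsion p) (γ ^ (i : ℕ)) u) = y i := by
  obtain ⟨c', hc', hc'd, hsur⟩ := curve_exists_forall_resOfLe_conjH1_pow_eq_at_vbar h263 h41 h42 h5A h32
    W hp hK hH hvι hvbar hne κ hκ γ hpair Sf hSf hSsub hSquot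
  obtain rfl : c = c' := eq_of_pow_generates κ (decomp (K := K) vbar) hc hcd hc' hc'd
  exact forall_fin_of_forall_nat
    (fun u ↦ u ∈ unramifiedOutside κ.kerSubgroup ((W.baseChange K).geomPrimaryTorsion p) p
      (↑Sf : Set (HeightOneSpectrum (𝓞 K))))
    (fun i u ↦ resOfLe ((W.baseChange K).geomPrimaryTorsion p)
      (inf_le_left : κ.kerSubgroup ⊓ decomp (K := K) vbar ≤ κ.kerSubgroup)
      (conjH1 κ.kerSubgroup ((W.baseChange K).geomPrimaryTorsion p) (γ ^ i) u))
    fun y ↦ by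
      obtain ⟨u, hu, -, hev⟩ := hsur y
      exact ⟨u, hu, hev⟩

end SurAtVbarFin

end Summit.BirchSwinnertonDyer.BirchSwinnertonDyer.Theorems.AcTwistDeformation

end
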